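import Summits.KontsevichZagierPeriods.KontsevichZagierPeriods.Theorems.RealEllipticSectorKernel.Negative.CMPoint

/-!
# `RealEllipticSectorKernel` (stmt-KontsevichZagierPeriods-10632) — negative knowledge, F15:
# the mirror `x ↦ −x` — `K₀(q₂,q₃) = J₀(q₂,−q₃)`, `K₁(q₂,q₃) = −J₁(q₂,−q₃)`; twist-invariance

Support file (cdisprove seat, cycle 3; work file `Cruxes/RealEllipticSectorKernel/Disproof.lean`, §14).
The reflection `x ↦ −x` maps the typed `σ'` of `(q₂,q₃)` onto the typed oval `σ` of the quadratic
twist `(q₂,−q₃)` (`f_{q₂,q₃}(−x) = −f_{q₂,−q₃}(x)`), so — for ALL parameters, by a measure-preserving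
reflection of `ℝ¹` (in the calculus: ONE rule-2 move, the ideators' "reflection transport", here at
the value level) — `K₀(q₂,q₃) = J₀(q₂,−q₃)` and `K₁(q₂,q₃) = −J₁(q₂,−q₃)`. Consequences:
the crux's inlined hypothesis is TWIST-INVARIANT (`rigidity_iff_twist`: the five numbers of
`(q₂,−q₃)` are a signed permutation of those of `(q₂,q₃)`), so every finding at `(q₂,q₃)` transfers
to `(q₂,−q₃)`: e.g. `¬Rigidity 44 56` (`not_rigidity_44_56`, from F9), and Core's `K₀ = J₀` at
`q₃ = 0` is the fixed point of the involution. [folklore]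
-/

noncomputable section

namespace Summit.KontsevichZagierPeriods.RealEllipticSectorKernel.Mirror

open MeasureTheory Set
open Summit.KontsevichZagierPeriods.RealEllipticSectorKernel.Negative

/-- `f_{q₂,q₃}(−x) = −f_{q₂,−q₃}(x)`. [folklore] -/
theorem cubic_neg (q₂ q₃ : ℚ) (x : ℝ) : cubic q₂ q₃ (-x) = -cubic q₂ (-q₃) x := by
  simp only [cubic, Rat.cast_neg]; ring

/-- `f_{q₂,−q₃}(−x) = −f_{q₂,q₃}(x)`. [folklore] -/
theorem cubic_twist_neg (q₂ q₃ : ℚ) (x : ℝ) : cubic q₂ (-q₃) (-x) = -cubic q₂ q₃ x := by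
  rw [cubic_neg, neg_neg]

/-- `σ'(q₂,q₃) = −σ(q₂,−q₃)` (as the preimage under `p ↦ −p`). [folklore] -/
theorem σ₂_eq_preimage_neg (q₂ q₃ : ℚ) : σ₂ q₂ q₃ = (fun p => -p) ⁻¹' σ₁ q₂ (-q₃) := by
  ext p
  simp only [σ₁, σ₂, mem_preimage, mem_setOf_eq, Pi.neg_apply, cubic_twist_neg]
  constructor
  · rintro ⟨h1, t, ht, h2⟩
    refine ⟨by linarith, -t, by linarith, ?_⟩
    rw [cubic_twist_neg]; linarith
  · rintro ⟨h1, t, ht, h2⟩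
    refine ⟨by linarith, -t, by linarith, ?_⟩
    rw [cubic_neg]; linarith

/-- Reflection of a set integral on `ℝ¹` (Lebesgue measure is invariant under `p ↦ −p`). [folklore] -/
theorem setIntegral_comp_neg (g : (Fin 1 → ℝ) → ℝ) (S : Set (Fin 1 → ℝ)) :
    ∫ p in (fun p => -p) ⁻¹' S, g (-p) = ∫ p in S, g p := by
  haveI : (volume : Measure (Fin 1 → ℝ)).IsNegInvariant :=
    Measure.IsAddHaarMeasure.isNegInvariant_of_regular _
  have hN : MeasurePreserving (fun p : Fin 1 → ℝ => -p) volume volume :=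
    Measure.measurePreserving_neg _
  have hemb : MeasurableEmbedding (fun p : Fin 1 → ℝ => -p) :=
    (MeasurableEquiv.neg (Fin 1 → ℝ)).measurableEmbedding
  exact hN.setIntegral_preimage_emb hemb g S

/-- **`K₀(q₂,q₃) = J₀(q₂,−q₃)`** for all parameters. [folklore] -/
theorem K₀_eq_J₀_twist (q₂ q₃ : ℚ) : K₀ q₂ q₃ = J₀ q₂ (-q₃) := by
  unfold K₀ J₀
  rw [σ₂_eq_preimage_neg,
    ← setIntegral_comp_neg (fun p => 1 / Real.sqrt (cubic q₂ (-q₃) (p 0))) (σ₁ q₂ (-q₃))]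
  refine integral_congr_ae (Filter.Eventually.of_forall fun p => ?_)
  simp only [Pi.neg_apply, cubic_twist_neg]

/-- **`K₁(q₂,q₃) = −J₁(q₂,−q₃)`** for all parameters. [folklore] -/
theorem K₁_eq_neg_J₁_twist (q₂ q₃ : ℚ) : K₁ q₂ q₃ = -J₁ q₂ (-q₃) := by
  unfold K₁ J₁
  rw [σ₂_eq_preimage_neg,
    ← setIntegral_comp_neg (fun p => p 0 / Real.sqrt (cubic q₂ (-q₃) (p 0))) (σ₁ q₂ (-q₃)),
    ← integral_neg]
  refine integral_congr_ae (Filter.Eventually.of_forall fun p => ?_)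
  simp only [Pi.neg_apply, cubic_twist_neg]
  ring

/-- `J₀(q₂,q₃) = K₀(q₂,−q₃)`. [folklore] -/
theorem J₀_eq_K₀_twist (q₂ q₃ : ℚ) : J₀ q₂ q₃ = K₀ q₂ (-q₃) := by
  rw [K₀_eq_J₀_twist, neg_neg]

/-- `J₁(q₂,q₃) = −K₁(q₂,−q₃)`. [folklore] -/
theorem J₁_eq_neg_K₁_twist (q₂ q₃ : ℚ) : J₁ q₂ q₃ = -K₁ q₂ (-q₃) := by
  rw [K₁_eq_neg_J₁_twist, neg_neg, neg_neg]

/-- One direction of twist-invariance. [folklore] -/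
theorem rigidity_twist {q₂ q₃ : ℚ} (h : Rigidity q₂ q₃) : Rigidity q₂ (-q₃) := by
  intro a b c d e ha hb hc hd he hrel
  rw [← K₀_eq_J₀_twist, K₀_eq_J₀_twist q₂ (-q₃), neg_neg, K₁_eq_neg_J₁_twist q₂ (-q₃), neg_neg]
    at hrel
  -- hrel : a + b K₀ + c J₁(q₂,-q₃) + d J₀ + e (−J₁) = 0, with J₁(q₂,-q₃) = −K₁(q₂,q₃)
  rw [show J₁ q₂ (-q₃) = -K₁ q₂ q₃ by rw [K₁_eq_neg_J₁_twist, neg_neg]] at hrel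
  have := h a d (-e) b (-c) ha hd he.neg hb hc.neg (by linear_combination hrel)
  obtain ⟨h0, h1, h2, h3, h4⟩ := this
  exact ⟨h0, h3, by linarith, h1, by linarith⟩

/-- **The crux's inlined hypothesis is twist-invariant**: `Rigidity q₂ q₃ ↔ Rigidity q₂ (−q₃)`.
[folklore] -/
theorem rigidity_iff_twist (q₂ q₃ : ℚ) : Rigidity q₂ q₃ ↔ Rigidity q₂ (-q₃) :=
  ⟨rigidity_twist, fun h => by simpa using rigidity_twist h⟩

/-- **(F15 ∘ F9) The hypothesis also fails at the mirror curve `(44, 56)`** (`K₀(44,56) = 2J₀(44,56)`).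
[folklore] -/
theorem not_rigidity_44_56 : ¬ Rigidity 44 56 := fun h =>
  CMPoint.not_rigidity_cm (by simpa using rigidity_twist h)

/-- `K₀(44,56) = 2·J₀(44,56)` (mirror of F9's `J₀(44,−56) = 2K₀(44,−56)`). [folklore] -/
theorem K₀_eq_two_mul_J₀_44_56 : K₀ 44 56 = 2 * J₀ 44 56 := by
  rw [K₀_eq_J₀_twist 44 56, J₀_eq_K₀_twist 44 56]
  exact CMPoint.J₀_eq_two_mul_K₀_cm

end Summit.KontsevichZagierPeriods.RealEllipticSectorKernel.Mirror
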